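import Summits.QuantumFields.YangMills.Theorems.LuscherReductionRunningReductionTraceFormulaDefs
import Summits.QuantumFields.YangMills.Theorems.FemtoTransferGapAxisPermutation
import HarnessLib

/-!
# Swap-twisted zero-flux thermal traces `Tr_phys(S (P K_β)^T)` on `(ℤ/L)³ × (ℤ/T)` — definitions

Defs module for the D-0145 LINE «SwapTwistDeficit» of seat ym-idea-4 (second route onto `ThermalTraceWindow.SubFemtoFirstLevel`,
item stmt-QuantumFields-28291).  The tree's closed kernel chain `TT.physTraceSucc L β n` (`Z_phys(L, β, n+1) = Tr (P K_β)^{n+1}`, seam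
`U_n → U_0` through `physAvg`) is closed instead through the AXIS SWAP `S = configPerm (Equiv.swap 0 1)` of the two spatial directions
`0, 1`: `twistTraceSucc L β n = ∫ (∏_{i<n} K_β(U_i,U_{i+1})) · (P K_β(U_n, ·))(S U_0) dU`.  Since `S` is a measure-preserving symmetry commuting
with `K_β` (`transferKernel_su2Rep_configPerm`) and with the physical average, this is the character-weighted ('t Hooft-twisted) trace
`Tr_{H_phys}(S T^{n+1}) = Σ_k s_k λ_k^{n+1}`, `s_k = ±1` the swap parity of the `k`-th zero-flux transfer eigenvector: the partition function of
Wilson's `SU(2)` theory on the `(n+1) × L³` torus whose temporal period is glued back with the spatial axes `0` and `1` exchanged.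
`Z_phys(T) − twistTrace(T) = 2 Σ_{s_k = -1} λ_k^T` is twice the thermal weight of the swap-odd sector.  Definitions only.
[cite: tHooft1979Flux] [cite: MontvayMunster1994, (3.145)] [cite: Luscher1983, §2]
-/

set_option autoImplicit false

noncomputable section

open MeasureTheory
open Literature.MathematicalPhysics.QuantumFieldTheory
open Literature.MathematicalPhysics.QuantumLattice
open scoped BigOperators

namespace Summit.QuantumFields.YangMills.Theorems.FemtoTransferGap.TT

open Summit.QuantumFields.YangMills.Theorems.FemtoTransferGap

/-- **Swap-twisted zero-flux thermal trace** over `n+1` time slices: the closed chain of `physTraceSucc L β n` with the seam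
`U_n → U_0` replaced by `U_n → S U_0`, `S` = exchange of the spatial axes `0` and `1` (`configPerm (Equiv.swap 0 1)`).
For `n+1 = T` it equals `Tr_phys(S (P K_β)^T) = Σ_k s_k λ_k^T`. [cite: tHooft1979Flux] [cite: MontvayMunster1994, (3.145)] -/
def twistTraceSucc (L : ℕ) [NeZero L] (β : ℝ) (n : ℕ) : ℝ :=
  ∫ Us : Fin (n + 1) → GaugeConfig 3 L SU2,
    (∏ i : Fin n, transferKernel su2Rep β (Us i.castSucc) (Us i.succ)) *
      physAvg (transferKernel su2Rep β (Us (Fin.last n))) (configPerm (Equiv.swap 0 1) (Us 0))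
    ∂(Measure.pi fun _ : Fin (n + 1) => configMeasure SU2 L)

/-- `Z^S_phys(L, β, T)` for `T ≥ 1` time steps (`T = 0` ↦ the one-step value, the junk convention of `physTrace`). [cite: tHooft1979Flux] -/
def twistTrace (L : ℕ) [NeZero L] (β : ℝ) (T : ℕ) : ℝ := twistTraceSucc L β (T - 1)

end Summit.QuantumFields.YangMills.Theorems.FemtoTransferGap.TT

end
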